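import Summits.CriticalPhenomena.SAWScalingLimit.Theses.SAWGaussianRotation
import Literature.Probability.RandomPlanarGeometry.SAWScalingLimitFamily
import Literature.Probability.RandomPlanarGeometry.ChordalRestrictionMarkov

/-!
# Birth skeleton for the split child `MarkovOfLimit` of `AxiomsOfLimit` (stmt-CriticalPhenomena-1370)

`MarkovOfLimit` (third child of the strategist's split of `AxiomsOfLimit`, route SAWGaussianRotation;
= `stub_markovOfLimit` of `Lines/split.lean`): every chordal full scaling limit `P` of the critical `δℤ²`
SAW laws that has the restriction property and is carried by simple boundary-avoiding curves admits a
restriction-coupled domain-Markov kernel `Q` (`P.IsMarkovExtension Q` and the restriction-kernel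
clause, i.e. `P.IsRestrictionMarkov` unfolded).

The child is not yet a route decl (the route-level `--split` is gated to the seat's final cycle), so its
statement is the local `def MarkovOfLimit` below (verbatim the text filed in `children.json`); once the
item exists, retarget `MarkovOfLimit_of` to `SAWGaussianRotation.MarkovOfLimit` (same text) and register
with `ledger skeleton check <this file> --crux <item>`.

## The cut: the kernel IS the scaling limit of the SAW in SLIT domains

At the lattice level the conditional law of the future of the critical SAW given its past up to the
hitting time of a closed set is, exactly, the critical SAW of the SLIT GRAPH `D_δ ∖ past` from the tip to
`b_δ` (Lawler–Schramm–Werner 2004 §2.3: "the rest of the walk is a SAW in the domain with `γ[0,t]`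
removed"). So the natural candidate for `Q D past` is the scaling limit of the critical SAW in the slit
domain `remainingDomain D past` — an OPEN set to which `SAW.law`, `discreteDomainGraph` and `meshPoint`
apply verbatim — from lattice points approximating the tip `past.target` to lattice points approximating
`b = D.pt 1` (`IsSlitApprox`, the slit analogue of `SAW.IsEndpointApprox`). `IsSlitLimitKernel Q` says:
`Q D past` is that limit whenever a slit approximation exists, and the zero measure otherwise (so that
the restriction-kernel clause is `0 = 0` off the approximable configurations; for `past` = the constant
curve at `a` the slit domain is `D` itself, `remainingDomain_mk_const`, and the clause is `(lim)`).

* S1 `stub_slitLimitKernel` (HARDEST, XL) — EXISTENCE OF THE SLIT-DOMAIN LIMITS AS A MARKOV EXTENSION: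
  for every chordal full limit `P` with restriction and simplicity there is `Q` with `IsSlitLimitKernel Q`
  and `P.IsMarkovExtension Q`. Content: (a) the critical SAW converges in every slit domain
  `D ∖ γ[0,σ]` that arises (extension of `(lim)` from Jordan to slit domains — the `(lim)` hypothesis
  only speaks of Jordan domains); (b) the lattice Markov identity passes to the limit as the
  disintegration clause `markov`, which needs the slit limits to be CONTINUOUS in the slit as the
  lattice past `γ_δ[0,σ] → γ[0,σ]` (stability under perturbation near the tip — the crux's recorded
  why-might-fail); (c) `initial` is `(lim)` + uniqueness of weak limits; `domain` holds by construction.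
* S2 `stub_slitRestrictionKernel` (L–XL) — RESTRICTION PASSAGE IN SLIT DOMAINS: for every `Q` with
  `IsSlitLimitKernel Q` (and `P` a chordal full limit with restriction, `P.IsMarkovExtension Q`), the
  restriction-kernel clause holds: conditioned into a Dobrushin sub-domain `D' ⊆ remainingDomain D past`
  pinned at the tip and at `b`, `Q D past` is `P D'`. Lattice level exact (`D'_δ ≤ (D ∖ past)_δ`, the
  restriction identity of LSW04 §3.4.5 for the slit graph); the passage is the slit analogue of the
  shared crux `RestrictionOfLimit` (portmanteau on the closed event `{range ⊆ cl D'}`, no loss of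
  avoidance mass), applied to the limit `Q D past` supplied by S1; off the approximable configurations
  both sides vanish.

`MarkovOfLimit_of : S1 → S2 → MarkovOfLimit` is five lines of logic (take `Q` from S1, its Markov
extension clause, and the kernel clause from S2).

References: G. F. Lawler, O. Schramm, W. Werner, *On the scaling limit of planar self-avoiding walk*
(2004), arXiv:math/0204277, §2.3, §3.4.2, §3.4.5; W. Werner, *Lectures on two-dimensional critical
percolation* (2007), §3.2 (2); O. Schramm, *Scaling limits of loop-erased random walks and uniform
spanning trees* (2000), §1 (domain Markov). All [folklore] at the level of statements.
-/

noncomputable section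

open MeasureTheory Filter Topology Set
open Literature.Probability.LatticeModels Literature.Probability.RandomPlanarGeometry

namespace Summit.CriticalPhenomena.SAWScalingLimit.Cruxes.AxiomsOfLimit.MarkovBirth

/-- **The split child `MarkovOfLimit`** (verbatim the statement filed for the route-level split; =
`stub_markovOfLimit` of `Lines/split.lean`). [cite: LawlerSchrammWerner2004SAW, §2.3 and §3.4.5] -/
def MarkovOfLimit : Prop :=
  ∀ P : Literature.Probability.RandomPlanarGeometry.ChordalFamily, P.IsChordal → (∀ (D : Literature.Probability.RandomPlanarGeometry.DobrushinDomain) (a b : ℝ → Literature.Probability.LatticeModels.Site 2), Literature.Probability.RandomPlanarGeometry.SAW.IsEndpointApprox D a b → Literature.Probability.RandomPlanarGeometry.TendstoLaw (fun δ (γ : Literature.Probability.RandomPlanarGeometry.SAW.DomainSAW D.carrier δ (a δ) (b δ)) => γ.curve) (fun δ => Literature.Probability.RandomPlanarGeometry.SAW.law D.carrier δ (a δ) (b δ)) id (P D)) → P.IsRestriction → (∀ D : Literature.Probability.RandomPlanarGeometry.DobrushinDomain, ∀ᵐ γ ∂(P D), γ ∈ Literature.Probability.RandomPlanarGeometry.CurveClass.simple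 ∧ γ.range ∩ frontier D.carrier ⊆ {D.pt 0, D.pt 1}) → ∃ Q : Literature.Probability.RandomPlanarGeometry.DobrushinDomain → Literature.Probability.RandomPlanarGeometry.CurveClass ℂ → MeasureTheory.Measure (Literature.Probability.RandomPlanarGeometry.CurveClass ℂ), P.IsMarkovExtension Q ∧ ∀ (D : Literature.Probability.RandomPlanarGeometry.DobrushinDomain) (p : Literature.Probability.RandomPlanarGeometry.CurveClass ℂ) (D' : Literature.Probability.RandomPlanarGeometry.DobrushinDomain), D'.carrier ⊆ Literature.Probability.RandomPlanarGeometry.remainingDomain D p → D'.pt 0 = p.target → D'.pt 1 = D.pt 1 → ∀ T : Set (Literature.Probability.RandomPlanarGeometry.CurveClass ℂ), MeasurableSet T → P D' T * Q D p (Literature.Probability.RandomPlanarGeometry.CurveClass.rangeSubset (closure D'.carrier)) = Q D p (T ∩ Literature.Probability.RandomPlanarGeometry.CurveClass.rangeSubset (closure D'.carrier))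

/-- **Slit endpoint approximation**: lattice endpoints `a'_δ`, `b'_δ` joined in the discretised slit
domain `(remainingDomain D past)_δ` for all small `δ`, with `δ a'_δ → past.target` (the tip) and
`δ b'_δ → b = D.pt 1` — the slit analogue of `SAW.IsEndpointApprox`. [folklore] -/
structure IsSlitApprox (D : DobrushinDomain) (past : CurveClass ℂ) (a' b' : ℝ → Site 2) : Prop where
  /-- for small `δ > 0`, `a' δ` and `b' δ` are joined in the discretised slit domain -/
  reachable : ∀ᶠ δ in 𝓝[>] (0 : ℝ),
    (discreteDomainGraph (remainingDomain D past) δ).Reachable (a' δ) (b' δ)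
  /-- `δ · a' δ →` the tip -/
  tendsto_fst : Tendsto (fun δ => meshPoint δ (a' δ)) (𝓝[>] (0 : ℝ)) (𝓝 past.target)
  /-- `δ · b' δ → b` -/
  tendsto_snd : Tendsto (fun δ => meshPoint δ (b' δ)) (𝓝[>] (0 : ℝ)) (𝓝 (D.pt 1))

/-- **`Q` is the slit-domain scaling-limit kernel of the critical SAW**: whenever `(D, past)` admits a
slit endpoint approximation, the critical SAW laws of the discretised slit domain from `a'_δ` to `b'_δ`,
pushed to curves, converge weakly along `δ → 0⁺` to `Q D past` (for EVERY slit approximation); otherwise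
`Q D past = 0`. [cite: LawlerSchrammWerner2004SAW, §2.3] -/
def IsSlitLimitKernel (Q : DobrushinDomain → CurveClass ℂ → Measure (CurveClass ℂ)) : Prop :=
  (∀ (D : DobrushinDomain) (past : CurveClass ℂ) (a' b' : ℝ → Site 2), IsSlitApprox D past a' b' →
      TendstoLaw (fun δ (γ : SAW.DomainSAW (remainingDomain D past) δ (a' δ) (b' δ)) => γ.curve)
        (fun δ => SAW.law (remainingDomain D past) δ (a' δ) (b' δ)) id (Q D past)) ∧
    ∀ (D : DobrushinDomain) (past : CurveClass ℂ),
      (¬ ∃ a' b' : ℝ → Site 2, IsSlitApprox D past a' b') → Q D past = 0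

/-! ### The stubs (the ONLY `sorry`s of this file) -/

/-- **S1 (hardest) — the slit-domain limits exist and form a Markov extension.** For every chordal full
scaling limit `P` of the critical `δℤ²` SAW with restriction and simplicity there is a slit-limit kernel
`Q` (`IsSlitLimitKernel Q`) which is a domain-Markov extension of `P` (`initial` = `(lim)` + uniqueness
of weak limits; `markov` = the exact lattice Markov identity passed to the limit, which needs continuity
of the slit limits in the slit; `domain` by construction). [cite: LawlerSchrammWerner2004SAW, §2.3] -/
theorem stub_slitLimitKernel :
    ∀ P : ChordalFamily, P.IsChordal → (∀ (D : Literature.Probability.RandomPlanarGeometry.DobrushinDomain) (a b : ℝ → Literature.Probability.LatticeModels.Site 2), Literature.Probability.RandomPlanarGeometry.SAW.IsEndpointApprox D a b → Literature.Probability.RandomPlanarGeometry.TendstoLaw (fun δ (γ : Literature.Probability.RandomPlanarGeometry.SAW.DomainSAW D.carrier δ (a δ) (b δ)) => γ.curve) (fun δ => Literature.Probability.RandomPlanarGeometry.SAW.law D.carrier δ (a δ) (b δ)) id (P D)) → P.IsRestriction → (∀ D : Literature.Probability.RandomPlanarGeometry.DobrushinDomain, ∀ᵐ γ ∂(P D),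 γ ∈ Literature.Probability.RandomPlanarGeometry.CurveClass.simple ∧ γ.range ∩ frontier D.carrier ⊆ {D.pt 0, D.pt 1}) →
      ∃ Q : DobrushinDomain → CurveClass ℂ → Measure (CurveClass ℂ),
        IsSlitLimitKernel Q ∧ P.IsMarkovExtension Q := by
  sorry

/-- **S2 — restriction passes to the slit-domain limits (the restriction-kernel clause).** For a chordal
full scaling limit `P` with restriction and a slit-limit kernel `Q` that is a Markov extension of `P`:
conditioned into any Dobrushin sub-domain `D'` of the slit domain pinned at the tip and at `b`, the
future has law `P D'` (product form). Exact at the lattice level (restriction identity for the slit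
graph); the passage is the slit analogue of `RestrictionOfLimit`; `0 = 0` off the approximable
configurations. [cite: LawlerSchrammWerner2004SAW, §3.4.5] -/
theorem stub_slitRestrictionKernel :
    ∀ (P : ChordalFamily) (Q : DobrushinDomain → CurveClass ℂ → Measure (CurveClass ℂ)),
      P.IsChordal → (∀ (D : Literature.Probability.RandomPlanarGeometry.DobrushinDomain) (a b : ℝ → Literature.Probability.LatticeModels.Site 2), Literature.Probability.RandomPlanarGeometry.SAW.IsEndpointApprox D a b → Literature.Probability.RandomPlanarGeometry.TendstoLaw (fun δ (γ : Literature.Probability.RandomPlanarGeometry.SAW.DomainSAW D.carrier δ (a δ) (b δ)) => γ.curve) (fun δ => Literature.Probability.RandomPlanarGeometry.SAW.law D.carrier δ (a δ) (b δ)) id (P D)) → P.IsRestriction → IsSlitLimitKernel Q → P.IsMarkovExtension Q →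
        ∀ (D : Literature.Probability.RandomPlanarGeometry.DobrushinDomain) (p : Literature.Probability.RandomPlanarGeometry.CurveClass ℂ) (D' : Literature.Probability.RandomPlanarGeometry.DobrushinDomain), D'.carrier ⊆ Literature.Probability.RandomPlanarGeometry.remainingDomain D p → D'.pt 0 = p.target → D'.pt 1 = D.pt 1 → ∀ T : Set (Literature.Probability.RandomPlanarGeometry.CurveClass ℂ), MeasurableSet T → P D' T * Q D p (Literature.Probability.RandomPlanarGeometry.CurveClass.rangeSubset (closure D'.carrier)) = Q D p (T ∩ Literature.Probability.RandomPlanarGeometry.CurveClass.rangeSubset (closure D'.carrier)) := by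
  sorry

/-! ### The skeleton theorem -/

/-- **`MarkovOfLimit` from S1 and S2** (no `sorry` of its own): take the slit-limit kernel `Q` of S1 with
its Markov-extension clause, and the restriction-kernel clause from S2. [folklore] -/
theorem MarkovOfLimit_of
    (h1 : ∀ P : ChordalFamily, P.IsChordal → (∀ (D : Literature.Probability.RandomPlanarGeometry.DobrushinDomain) (a b : ℝ → Literature.Probability.LatticeModels.Site 2), Literature.Probability.RandomPlanarGeometry.SAW.IsEndpointApprox D a b → Literature.Probability.RandomPlanarGeometry.TendstoLaw (fun δ (γ : Literature.Probability.RandomPlanarGeometry.SAW.DomainSAW D.carrier δ (a δ) (b δ)) => γ.curve) (fun δ => Literature.Probability.RandomPlanarGeometry.SAW.law D.carrier δ (a δ) (b δ)) id (P D)) → P.IsRestriction → (∀ D : Literature.Probability.RandomPlanarGeometry.DobrushinDomain, ∀ᵐ γ ∂(P D), γ ∈ Literature.Probability.RandomPlanarGeometry.CurveClass.simple ∧ γ.range ∩ frontier D.carrier ⊆ {D.pt 0, D.pt 1}) →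
      ∃ Q : DobrushinDomain → CurveClass ℂ → Measure (CurveClass ℂ),
        IsSlitLimitKernel Q ∧ P.IsMarkovExtension Q)
    (h2 : ∀ (P : ChordalFamily) (Q : DobrushinDomain → CurveClass ℂ → Measure (CurveClass ℂ)),
      P.IsChordal → (∀ (D : Literature.Probability.RandomPlanarGeometry.DobrushinDomain) (a b : ℝ → Literature.Probability.LatticeModels.Site 2), Literature.Probability.RandomPlanarGeometry.SAW.IsEndpointApprox D a b → Literature.Probability.RandomPlanarGeometry.TendstoLaw (fun δ (γ : Literature.Probability.RandomPlanarGeometry.SAW.DomainSAW D.carrier δ (a δ) (b δ)) => γ.curve) (fun δ => Literature.Probability.RandomPlanarGeometry.SAW.law D.carrier δ (a δ) (b δ)) id (P D)) → P.IsRestriction → IsSlitLimitKernel Q → P.IsMarkovExtension Q →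
        ∀ (D : Literature.Probability.RandomPlanarGeometry.DobrushinDomain) (p : Literature.Probability.RandomPlanarGeometry.CurveClass ℂ) (D' : Literature.Probability.RandomPlanarGeometry.DobrushinDomain), D'.carrier ⊆ Literature.Probability.RandomPlanarGeometry.remainingDomain D p → D'.pt 0 = p.target → D'.pt 1 = D.pt 1 → ∀ T : Set (Literature.Probability.RandomPlanarGeometry.CurveClass ℂ), MeasurableSet T → P D' T * Q D p (Literature.Probability.RandomPlanarGeometry.CurveClass.rangeSubset (closure D'.carrier)) = Q D p (T ∩ Literature.Probability.RandomPlanarGeometry.CurveClass.rangeSubset (closure D'.carrier))) :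
    MarkovOfLimit := by
  intro P hch hlim hr hs
  obtain ⟨Q, hK, hM⟩ := h1 P hch hlim hr hs
  exact ⟨Q, hM, h2 P Q hch hlim hr hK hM⟩

/-- Wiring check. -/
example : MarkovOfLimit := MarkovOfLimit_of stub_slitLimitKernel stub_slitRestrictionKernel

end Summit.CriticalPhenomena.SAWScalingLimit.Cruxes.AxiomsOfLimit.MarkovBirth

end
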